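import Mathlib
import Summits.ValiantsHypothesis.ValiantsHypothesis.Theorems.BarrierLeverPartitionMinorsHitByVPSimplexJoinPieceCount
import Summits.ValiantsHypothesis.ValiantsHypothesis.Theorems.BarrierLeverPartitionMinorsHitByVPSimplexJoinPatternTwoZero
import Summits.ValiantsHypothesis.ValiantsHypothesis.Theorems.BarrierLeverPartitionMinorsHitByVPSimplexJoinPatternTwoOne
import Summits.ValiantsHypothesis.ValiantsHypothesis.Theorems.BarrierLeverPartitionMinorsHitByVPSimplexJoinPatternOneOne
import Summits.ValiantsHypothesis.ValiantsHypothesis.Theorems.BarrierLeverPartitionMinorsHitByVPSimplexJoinPatternOneZero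

/-!
# Route BarrierLever — item `PartitionMinorsHitByVP` (19717): `Stmt.pieceKill` for pieces with EXACTLY TWO live slots
Helper file (`--supports stmt-ValiantsHypothesis-19717`; cell valiant-natproofs, 𝒟-side door (c), line `hidden_states`, uniform-menu
lane; prover seat val-np-p3 gen 12). Definition-free; closes NO item. Assembly of the k = 2 part of the case map toward `Stmt.pieceKill H₀`
(memo val-np-p3 g12 §2(f)–(g)): **`pieceKill_twoLive`** — a one-piece exact-support design whose live slots are exactly `f₁, f₂`
(`1 ≤ s₂ ≤ s₁ ≤ (2h)²`), with `(2h)²+2 ≤ n ≤ (2h)²((2h)²+1)+1` columns, has an injective row family on which every table is singular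
(`h ≥ 2^40`). Dispatch on the levels of `s₁, s₂` at `A = univ` (`c₁ = h+1`, `c₂ = 1+h+C(h,2)`): (0,0) is impossible
(`n ≤ (h+1)² < (2h)²+2`); (1,0) `pieceKill_pattern10` (p636507); (1,1) `pieceKill_pattern11` (p635932); (2,0) `pieceKill_pattern20`
(p634850); (2,1) `pieceKill_pattern21` (p635134); (2,2) is DEEP: all `n ≤ C(h,5)` smallest rows have size `≤ 5` (`leaf_allSmall` at
`a = h`, `arith_deep22`). Column count `n = (s₁+1)(s₂+1)` from `card_columns_two_slots` (p634327). What remains for `Stmt.pieceKill`: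
pieces with 3, 4, 5 live slots (shallow patterns (0,0,0),(1,0,0),(1,1,0),(2,0,0),(0⁴),(1,0³),(0⁵) + their deep cases) and ≥ 6 (six-slot lemma).
-/

set_option linter.dupNamespace false

namespace Summit.ValiantsHypothesis.ValiantsHypothesis.Theorems.BarrierLever.SimplexJoin

open Finset Matrix

/-- Arithmetic of the deep leaf: `120·((2h)²((2h)²+1)+1) ≤ (h−4)⁵` for `h ≥ 2^12`. -/
theorem arith_deep22 (h : ℕ) (hh : 2 ^ 12 ≤ h) : 120 * ((h + h) ^ 2 * ((h + h) ^ 2 + 1) + 1) ≤ (h - 4) ^ 5 := by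
  obtain ⟨c, rfl⟩ : ∃ c, h = c + 4 := ⟨h - 4, by omega⟩
  rw [show c + 4 - 4 = c by omega]
  have hc : 4000 ≤ c := by omega
  have G2 : 4000 * (c * (c * (c * c))) ≤ c * (c * (c * (c * c))) := Nat.mul_le_mul_right _ hc
  have G3 : 4000 * (c * (c * c)) ≤ c * (c * (c * c)) := Nat.mul_le_mul_right _ hc
  have G4 : 4000 * (c * c) ≤ c * (c * c) := Nat.mul_le_mul_right _ hc
  have G5 : 4000 * c ≤ c * c := Nat.mul_le_mul_right _ hc
  nlinarith [G2, G3, G4, G5]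

/-- **`Stmt.pieceKill` for exactly two live slots** (`h ≥ 2^40`). -/
theorem pieceKill_twoLive (h D N n : ℕ) (hh : 2 ^ 40 ≤ h) (S : Fin 1 → Fin D → Finset (Fin N))
    (e : Fin n → Fin 1 × (Fin D → Option (Fin N))) (he : Function.Injective e)
    (hlive : ∀ c : Fin 1 × (Fin D → Option (Fin N)),
      c ∈ Set.range e ↔ ∀ (f : Fin D) (j : Fin N), c.2 f = some j → j ∈ S c.1 f)
    (f₁ f₂ : Fin D) (hf : f₁ ≠ f₂) (hs₂₁ : (S 0 f₂).card ≤ (S 0 f₁).card) (hs₂ : 1 ≤ (S 0 f₂).card)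
    (hs₁N : (S 0 f₁).card ≤ (h + h) ^ 2) (hdead : ∀ f, f ≠ f₁ → f ≠ f₂ → S 0 f = ∅)
    (hnlo : (h + h) ^ 2 + 2 ≤ n) (hnhi : n ≤ (h + h) ^ 2 * ((h + h) ^ 2 + 1) + 1) :
    ∃ v : Fin n → Finset (Fin h), Function.Injective v ∧
      ∀ T : Fin 1 → Option (Fin D × Fin N) → Fin h → ℂ,
        (Matrix.of fun x x' : Fin n => ∏ a ∈ v x,
          (T (e x').1 none a + ∑ f : Fin D, ((e x').2 f).elim 0 fun j => T (e x').1 (some (f, j)) a)).det = 0 := by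
  classical
  set s₁ := (S 0 f₁).card with hs₁def
  set s₂ := (S 0 f₂).card with hs₂def
  -- column count
  have hn : n = (s₁ + 1) * (s₂ + 1) := by
    obtain ⟨hcount, -⟩ := card_columns_two_slots S e he hlive f₁ f₂ hf
    have hQ : ∏ f ∈ (Finset.univ.erase f₁).erase f₂, ((S 0 f).card + 1) = 1 := by
      refine Finset.prod_eq_one fun f hfm => ?_
      have hf2 : f ≠ f₂ := (Finset.mem_erase.mp hfm).1
      have hf1 : f ≠ f₁ := (Finset.mem_erase.mp (Finset.mem_erase.mp hfm).2).1
      rw [hdead f hf1 hf2]; simp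
    rw [hQ, mul_one] at hcount
    exact hcount
  have hlev1 : ∑ i ∈ Finset.range 2, h.choose i = h + 1 := by simp [Finset.sum_range_succ, add_comm]
  by_cases h1lo : s₁ < h + 1
  · -- (0,0): impossible
    exfalso
    have : n ≤ (h + 1) * (h + 1) := by rw [hn]; exact Nat.mul_le_mul (by omega) (by omega)
    nlinarith
  push Not at h1lo
  by_cases h1c : s₁ < ∑ i ∈ Finset.range 3, h.choose i
  · -- slot 1 at level 1
    by_cases h2lo : s₂ < h + 1
    · exact pieceKill_pattern10 h D N n hh S e he hlive f₁ f₂ hf h1lo h1c hs₂ (by omega) hn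
    · exact pieceKill_pattern11 h D N n hh S e he hlive f₁ f₂ hf (by rw [hlev1]; exact h1lo) h1c
        (by rw [hlev1]; omega) hs₂₁ hn
  · -- slot 1 at level 2
    push Not at h1c
    by_cases h2lo : s₂ < h + 1
    · exact pieceKill_pattern20 h D N n (by omega) S e he hlive f₁ f₂ hf h1c hs₁N hs₂ (by omega) hn
    push Not at h2lo
    by_cases h2c : s₂ < ∑ i ∈ Finset.range 3, h.choose i
    · exact pieceKill_pattern21 h D N n hh S e he hlive f₁ f₂ hf h1c hs₁N (by rw [hlev1]; exact h2lo) h2c hn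
    · -- (2,2): DEEP — all rows of size ≤ 5 at `A = univ`
      push Not at h2c
      have hdeep := arith_deep22 h (by omega)
      have hC5 : (h - 4) ^ 5 ≤ 120 * h.choose 5 := by
        have h1 := Nat.pow_sub_le_descFactorial h 5
        rw [Nat.descFactorial_eq_factorial_mul_choose, show Nat.factorial 5 = 120 by rfl,
          show h + 1 - 5 = h - 4 by omega] at h1
        exact h1
      have hnC5 : n ≤ h.choose 5 := by
        have : 120 * n ≤ 120 * h.choose 5 := (Nat.mul_le_mul_left _ hnhi).trans (hdeep.trans hC5)
        omega
      exact leaf_allSmall h D N n 2 2 h S e he hlive f₁ f₂ hf le_rfl (hnC5.trans (Nat.choose_le_two_pow h 5))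
        (hnC5.trans (Finset.single_le_sum (f := fun i => h.choose i) (fun i _ => Nat.zero_le _)
          (Finset.mem_range.mpr (by norm_num)))) h1c h2c

end Summit.ValiantsHypothesis.ValiantsHypothesis.Theorems.BarrierLever.SimplexJoin
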